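import Summits.QuantumFields.YangMills.Theorems.BalabanUVNodesN19BirkhoffContraction

/-!
# BalabanUVNodes ∕ N19 (NE7) — BIRKHOFF's CONTRACTION THEOREM, III: HOPF's INTEGRAL FORM (rows and vectors on a measure space)

Cell `pub-ymgap` (HUMAN RULING D-0062 Track A; D-0149 width seats), seat `pub-ymgap-dag-n19-w2` (WIDTH SEAT 2 of 3 on NODE n19 = NE7), generation
g6, CLAIM-2 (INBOX l.34667).  Route `Summits/QuantumFields/YangMills/Theses/BalabanUVNodes.lean`, key item K3⁷ `SpineGivenEndpointR13SepCoPH`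
(stmt-QuantumFields-20544); filed `--kind proof --supports … --as helper`.  COUNT-NEUTRAL.  THEOREMS ONLY (0 `def`, 0 `sorry`).  ADDITIVE — imports this
seat's g6 `…N19BirkhoffContraction` (p618587: the algebra `four_var_le`, `tanh_quarter_nonneg`, `two_mul_log_birkhoff_le_tanh_mul`) ONLY (Mathlib's
`MeasureTheory.integral_prod_mul` ∕ `Integrable.mul_prod` through `import Mathlib` there); modifies nothing.

WHY.  `…N19BirkhoffContraction` proved Birkhoff's two-row inequality for rows and vectors on a FINITE index set (the class index of `Spine.NE7.Core`).
The lineage's class-LAW currencies (n19-c's MASS_cl ∕ TV_cl ∕ SHAPE_cl, this seat's g0 density-form face, g4 kernel chains, g5 affinity) live one level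
down, on MEASURE spaces: a renormalisation step integrates a density against a kernel over a continuum fibre.  This file is the same theorem with `Σ_{k ∈ s}`
replaced by `∫ … dμ` over a σ-finite measure space — E. Hopf's setting (1963; Eveson–Nussbaum 1995, Math. Proc. Camb. Phil. Soc. 117, Thm 3.5 p. 39 state it
for general cones, which covers both) — so that `…N19ShapeSandwichCommonStep` can contract the SHAPE_cl measure sandwich under a common kernel with a density.
The proof is the finite one with the cross-ratio passage done by Fubini (`integral_prod_mul` on `μ.prod μ`) and the dictionary read on the four real
numbers `∫ a x`, `∫ a y`, `∫ b x`, `∫ b y` (so no integral is manipulated beyond linearity and monotonicity); the algebra is p618587's `four_var_le` BY NAME.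
* §0 `integral_pos_of_pos` (an everywhere-positive integrable function on a non-zero measure space has positive integral) · `integral_mul_sub_eq` ∕
  `integral_mul_sub_eq'` (the linearity dictionary).
* §1 ★★ `integral_mul_integral_le_birkhoff` — rows `a, b > 0`, vector `x > 0`, `αx ≤ y ≤ p²αx` (everywhere; `α > 0`, `p, q ≥ 1`), cross-ratios
  `a s · b s′ ≤ q² · a s′ · b s`, the four products integrable ⇒ `(∫ a y)(∫ b x)(p + q)² ≤ (∫ a x)(∫ b y)(pq + 1)²`.
* §2 ★★ `integral_mul_integral_le_birkhoff_exp` — the `d, Δ` form (vectors with `y s · x s′ ≤ e^d · x s · y s′`, rows with `a s · b s′ ≤ e^Δ · a s′ · b s`;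
  `α := inf y∕x`, `p = e^{d∕2}`, `q = e^{Δ∕2}`): `(∫ a y)(∫ b x)(e^{d∕2} + e^{Δ∕2})² ≤ (∫ a x)(∫ b y)(e^{(d+Δ)∕2} + 1)²` — the sharp value · ★★
  `integral_mul_integral_le_exp_tanh_mul` — Birkhoff's coefficient folded in: `(∫ a y)(∫ b x) ≤ e^{tanh(Δ∕4)·d} · (∫ a x)(∫ b y)` · ★
  `integral_mul_integral_le_exp_dist` (WEAK BOUND I: ANY non-negative rows, `≤ e^d`) · `integral_mul_integral_le_exp_diam` (WEAK BOUND II: `≤ e^Δ`).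
* §3 `densityChain_pos` · ★★ `densityChain_dist_le_pow` — two positive densities evolved by the SAME positive kernels of diameter `≤ Δ` are at Hilbert
  distance `≤ tanh(Δ∕4)^n·ω₀` after `n` steps (the measure-space twin of p618587's `chain_dist_le_pow`).
Hypotheses are stated EVERYWHERE rather than μ-a.e. (a SHAPE; modify on a null set to apply).

HONEST FRAMING.  Count-neutral helper; [folklore]-grade positive-operator theory on hypothesis SHAPES; ZERO Bałaban content (no RG step of
[Balaban1988Convergent] ∕ [Balaban1989LargeFieldI ∕ II] is shown to have a density of finite cross-ratio diameter; realistic diameters are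
volume-extensive, `…N19BirkhoffContractionSharp.crossRatio_le_of_boltzmann`); NE2–NE7 ∕ NE1′ NOT PRINTED for d = 4 ∕ NOT proved; N19 NOT discharged;
K3⁷ OPEN, v5 untouched, not claimed; counts UNMOVED (typed 28∕28 · discharged 5∕27, A 5∕28); no count claim.  One finite 𝕋⁴ programme at fixed ε,
Bałaban AS PRINTED; R4 closes the conditional finite-𝕋⁴ rung `BalabanLadder.UV` only — the YM mass gap (Clay) is NOT proved by any of this; nothing
continuum ∕ ℝ⁴ ∕ OS.  No `def`, no `instance`, no `sorry`; standard axioms.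
-/

noncomputable section

open MeasureTheory Real
open Summit.QuantumFields.YangMills.BalabanUVNodes.N19BirkhoffContraction
  (four_var_le tanh_quarter_nonneg two_mul_log_birkhoff_le_tanh_mul)

namespace Summit.QuantumFields.YangMills.BalabanUVNodes.N19BirkhoffContractionIntegral

variable {X : Type*} [MeasurableSpace X] {μ : Measure X}

/-- an everywhere-positive integrable function on a non-zero measure space has positive integral. [folklore] -/
theorem integral_pos_of_pos (hμ : μ ≠ 0) {f : X → ℝ} (hf : ∀ s, 0 < f s) (hfi : Integrable f μ) :
    0 < ∫ s, f s ∂μ := by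
  rw [integral_pos_iff_support_of_nonneg_ae (Filter.Eventually.of_forall fun s => (hf s).le) hfi]
  have hs : Function.support f = Set.univ := Set.eq_univ_of_forall fun s => (hf s).ne'
  rw [hs]
  exact pos_iff_ne_zero.2 (by rwa [Ne, Measure.measure_univ_eq_zero])

/-- linearity dictionary: `∫ a·(y − αx) = ∫ a y − α ∫ a x`. [folklore] -/
theorem integral_mul_sub_eq {a x y : X → ℝ} {α : ℝ}
    (hax : Integrable (fun s => a s * x s) μ) (hay : Integrable (fun s => a s * y s) μ) :
    ∫ s, a s * (y s - α * x s) ∂μ = (∫ s, a s * y s ∂μ) - α * ∫ s, a s * x s ∂μ := by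
  have e : (fun s => a s * (y s - α * x s)) = fun s => a s * y s - α * (a s * x s) := funext fun s => by ring
  rw [e, integral_sub hay (hax.const_mul α), integral_const_mul]

/-- linearity dictionary: `∫ a·(βx − y) = β ∫ a x − ∫ a y`. [folklore] -/
theorem integral_mul_sub_eq' {a x y : X → ℝ} {β : ℝ}
    (hax : Integrable (fun s => a s * x s) μ) (hay : Integrable (fun s => a s * y s) μ) :
    ∫ s, a s * (β * x s - y s) ∂μ = β * (∫ s, a s * x s ∂μ) - ∫ s, a s * y s ∂μ := by
  have e : (fun s => a s * (β * x s - y s)) = fun s => β * (a s * x s) - a s * y s := funext fun s => by ring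
  rw [e, integral_sub (hax.const_mul β) hay, integral_const_mul]

/-! ## §1 Hopf's integral form of Birkhoff's two-row inequality -/

section TwoRows

variable [SFinite μ] {a b x y : X → ℝ} {α p q d Δ : ℝ}

/-- **★★ BIRKHOFF's TWO-ROW INEQUALITY, INTEGRAL FORM** [folklore] (Hopf 1963; Eveson–Nussbaum 1995 Thm 3.5 p. 39).  On a σ-finite measure space: rows
`a, b > 0` with cross-ratios `a s·b s′ ≤ q²·a s′·b s` (`q ≥ 1`), a vector `x > 0` and `αx ≤ y ≤ p²αx` (`α > 0`, `p ≥ 1`), the four products integrable ⇒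
`(∫ a y)(∫ b x)(p + q)² ≤ (∫ a x)(∫ b y)(pq + 1)²`.  Proof: `u_a = ∫ a y − α∫ a x`, `v_a = p²α∫ a x − ∫ a y` (and `u_b, v_b`) are non-negative, the rows'
cross-ratio bound passes to `u_a v_b ≤ q² u_b v_a` by Fubini, and p618587's `four_var_le` concludes. -/
theorem integral_mul_integral_le_birkhoff (hp : 1 ≤ p) (hq : 1 ≤ q) (hα : 0 < α)
    (ha : ∀ s, 0 < a s) (hb : ∀ s, 0 < b s) (hx : ∀ s, 0 < x s)
    (hlo : ∀ s, α * x s ≤ y s) (hhi : ∀ s, y s ≤ p ^ 2 * (α * x s))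
    (hcross : ∀ s s', a s * b s' ≤ q ^ 2 * (a s' * b s))
    (hax : Integrable (fun s => a s * x s) μ) (hay : Integrable (fun s => a s * y s) μ)
    (hbx : Integrable (fun s => b s * x s) μ) (hby : Integrable (fun s => b s * y s) μ) :
    (∫ s, a s * y s ∂μ) * (∫ s, b s * x s ∂μ) * (p + q) ^ 2 ≤
      (∫ s, a s * x s ∂μ) * (∫ s, b s * y s ∂μ) * (p * q + 1) ^ 2 := by
  by_cases hμ : μ = 0
  · subst hμ; simp
  rcases eq_or_lt_of_le hp with rfl | hp1
  · -- `p = 1`: `y = αx`, both sides coincide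
    have hyx : ∀ s, y s = α * x s := fun s => le_antisymm (by simpa using hhi s) (hlo s)
    have e1 : ∫ s, a s * y s ∂μ = α * ∫ s, a s * x s ∂μ := by
      rw [← integral_const_mul]; exact integral_congr_ae (Filter.Eventually.of_forall fun s => by simp only [hyx s]; ring)
    have e2 : ∫ s, b s * y s ∂μ = α * ∫ s, b s * x s ∂μ := by
      rw [← integral_const_mul]; exact integral_congr_ae (Filter.Eventually.of_forall fun s => by simp only [hyx s]; ring)
    rw [e1, e2]
    exact le_of_eq (by ring)
  -- `p > 1`
  set Ay := ∫ s, a s * y s ∂μ with hAy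
  set Ax := ∫ s, a s * x s ∂μ with hAx
  set By := ∫ s, b s * y s ∂μ with hBy
  set Bx := ∫ s, b s * x s ∂μ with hBx
  -- the four non-negativities
  have hua : α * Ax ≤ Ay := by
    rw [hAx, hAy, ← integral_const_mul]
    exact integral_mono (hax.const_mul α) hay fun s => by
      have := mul_le_mul_of_nonneg_left (hlo s) (ha s).le
      simpa only [mul_comm, mul_left_comm, mul_assoc] using this
  have hva : Ay ≤ p ^ 2 * α * Ax := by
    rw [hAx, hAy, ← integral_const_mul]
    exact integral_mono hay (hax.const_mul (p ^ 2 * α)) fun s => by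
      have := mul_le_mul_of_nonneg_left (hhi s) (ha s).le
      simp only at this ⊢; nlinarith [this]
  have hub : α * Bx ≤ By := by
    rw [hBx, hBy, ← integral_const_mul]
    exact integral_mono (hbx.const_mul α) hby fun s => by
      have := mul_le_mul_of_nonneg_left (hlo s) (hb s).le
      simpa only [mul_comm, mul_left_comm, mul_assoc] using this
  have hvb : By ≤ p ^ 2 * α * Bx := by
    rw [hBx, hBy, ← integral_const_mul]
    exact integral_mono hby (hbx.const_mul (p ^ 2 * α)) fun s => by
      have := mul_le_mul_of_nonneg_left (hhi s) (hb s).le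
      simp only at this ⊢; nlinarith [this]
  -- the cross-ratio bound passes to `(u, v)` by Fubini
  have hFa : Integrable (fun s => a s * (y s - α * x s)) μ := by
    have e : (fun s => a s * (y s - α * x s)) = fun s => a s * y s - α * (a s * x s) := funext fun s => by ring
    rw [e]; exact hay.sub (hax.const_mul α)
  have hFb : Integrable (fun s => b s * (y s - α * x s)) μ := by
    have e : (fun s => b s * (y s - α * x s)) = fun s => b s * y s - α * (b s * x s) := funext fun s => by ring
    rw [e]; exact hby.sub (hbx.const_mul α)
  have hGa : Integrable (fun s => a s * (p ^ 2 * α * x s - y s)) μ := by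
    have e : (fun s => a s * (p ^ 2 * α * x s - y s)) = fun s => p ^ 2 * α * (a s * x s) - a s * y s := funext fun s => by ring
    rw [e]; exact (hax.const_mul _).sub hay
  have hGb : Integrable (fun s => b s * (p ^ 2 * α * x s - y s)) μ := by
    have e : (fun s => b s * (p ^ 2 * α * x s - y s)) = fun s => p ^ 2 * α * (b s * x s) - b s * y s := funext fun s => by ring
    rw [e]; exact (hbx.const_mul _).sub hby
  have hc : (Ay - α * Ax) * (p ^ 2 * α * Bx - By) ≤ q ^ 2 * ((By - α * Bx) * (p ^ 2 * α * Ax - Ay)) := by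
    rw [hAy, hAx, hBy, hBx, ← integral_mul_sub_eq hax hay, ← integral_mul_sub_eq' hbx hby, ← integral_mul_sub_eq hbx hby,
      ← integral_mul_sub_eq' hax hay, ← integral_prod_mul, ← integral_prod_mul, ← integral_const_mul]
    refine integral_mono (hFa.mul_prod hGb) ((hFb.mul_prod hGa).const_mul _) fun z => ?_
    have h1 : 0 ≤ y z.1 - α * x z.1 := sub_nonneg.2 (hlo z.1)
    have h2 : 0 ≤ p ^ 2 * α * x z.2 - y z.2 := sub_nonneg.2 (by rw [mul_assoc]; exact hhi z.2)
    calc a z.1 * (y z.1 - α * x z.1) * (b z.2 * (p ^ 2 * α * x z.2 - y z.2))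
        = (a z.1 * b z.2) * ((y z.1 - α * x z.1) * (p ^ 2 * α * x z.2 - y z.2)) := by ring
      _ ≤ (q ^ 2 * (a z.2 * b z.1)) * ((y z.1 - α * x z.1) * (p ^ 2 * α * x z.2 - y z.2)) :=
          mul_le_mul_of_nonneg_right (hcross z.1 z.2) (mul_nonneg h1 h2)
      _ = q ^ 2 * (b z.1 * (y z.1 - α * x z.1) * (a z.2 * (p ^ 2 * α * x z.2 - y z.2))) := by ring
  -- positivity of `u_b + v_b = (p²α − α)·∫ b x`
  have hBx0 : 0 < Bx := integral_pos_of_pos hμ (fun s => mul_pos (hb s) (hx s)) hbx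
  have hp21 : 0 < p ^ 2 - 1 := by nlinarith
  have hpos : 0 < (By - α * Bx) + (p ^ 2 * α * Bx - By) := by
    have : (By - α * Bx) + (p ^ 2 * α * Bx - By) = α * (p ^ 2 - 1) * Bx := by ring
    rw [this]; positivity
  have h4 := four_var_le hp hq (sub_nonneg.2 hua) (sub_nonneg.2 hva) (sub_nonneg.2 hub) hpos hc
  have key : α * (p ^ 2 - 1) ^ 2 * (Ay * Bx * (p + q) ^ 2) ≤ α * (p ^ 2 - 1) ^ 2 * (Ax * By * (p * q + 1) ^ 2) :=
    calc α * (p ^ 2 - 1) ^ 2 * (Ay * Bx * (p + q) ^ 2)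
        = (p ^ 2 * (Ay - α * Ax) + (p ^ 2 * α * Ax - Ay)) * ((By - α * Bx) + (p ^ 2 * α * Bx - By)) * (p + q) ^ 2 := by ring
      _ ≤ ((Ay - α * Ax) + (p ^ 2 * α * Ax - Ay)) * (p ^ 2 * (By - α * Bx) + (p ^ 2 * α * Bx - By)) * (p * q + 1) ^ 2 := h4
      _ = α * (p ^ 2 - 1) ^ 2 * (Ax * By * (p * q + 1) ^ 2) := by ring
  exact le_of_mul_le_mul_left key (by positivity)

/-! ## §2 The `d, Δ` form with Birkhoff's coefficient; the two weak bounds -/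

/-- **★★ INTEGRAL FORM WITH BIRKHOFF's COEFFICIENT** [folklore] (Hopf 1963; Eveson–Nussbaum 1995 Thm 3.5).  Rows `a, b > 0` with `a s·b s′ ≤ e^Δ·a s′·b s`
(cross-ratio diameter `≤ Δ`, `Δ ≥ 0`), vectors `x, y > 0` with `y s·x s′ ≤ e^d·x s·y s′` (Hilbert distance `≤ d`, `d ≥ 0`), products integrable ⇒
`(∫ a y)(∫ b x)·(e^{d∕2} + e^{Δ∕2})² ≤ (∫ a x)(∫ b y)·(e^{(d+Δ)∕2} + 1)²` — §1 at `α := inf y∕x`, `p = e^{d∕2}`, `q = e^{Δ∕2}`. -/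
theorem integral_mul_integral_le_birkhoff_exp (hd : 0 ≤ d) (hΔ : 0 ≤ Δ)
    (ha : ∀ s, 0 < a s) (hb : ∀ s, 0 < b s) (hx : ∀ s, 0 < x s) (hy : ∀ s, 0 < y s)
    (hxy : ∀ s s', y s * x s' ≤ exp d * (x s * y s')) (hab : ∀ s s', a s * b s' ≤ exp Δ * (a s' * b s))
    (hax : Integrable (fun s => a s * x s) μ) (hay : Integrable (fun s => a s * y s) μ)
    (hbx : Integrable (fun s => b s * x s) μ) (hby : Integrable (fun s => b s * y s) μ) :
    (∫ s, a s * y s ∂μ) * (∫ s, b s * x s ∂μ) * (exp (d / 2) + exp (Δ / 2)) ^ 2 ≤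
      (∫ s, a s * x s ∂μ) * (∫ s, b s * y s ∂μ) * (exp ((d + Δ) / 2) + 1) ^ 2 := by
  by_cases hμ : μ = 0
  · subst hμ; simp
  have hX : Nonempty X := by
    by_contra h
    rw [not_nonempty_iff] at h
    exact hμ (Measure.eq_zero_of_isEmpty μ)
  obtain ⟨s₀⟩ := hX
  -- the ratio `r = y∕x`, its infimum `α`, and `αx ≤ y ≤ e^d αx`
  set r : X → ℝ := fun s => y s / x s with hr
  have hr0 : ∀ s, 0 < r s := fun s => div_pos (hy s) (hx s)
  have hrr : ∀ s s', r s ≤ exp d * r s' := by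
    intro s s'
    have h := hxy s s'
    have hxs : x s ≠ 0 := (hx s).ne'
    have hxs' : x s' ≠ 0 := (hx s').ne'
    calc r s = (y s * x s') / (x s * x s') := by rw [hr]; field_simp
      _ ≤ (exp d * (x s * y s')) / (x s * x s') := div_le_div_of_nonneg_right h (mul_pos (hx s) (hx s')).le
      _ = exp d * r s' := by rw [hr]; field_simp
  have hbdd : BddBelow (Set.range r) := ⟨0, by rintro _ ⟨s, rfl⟩; exact (hr0 s).le⟩
  have hne : (Set.range r).Nonempty := ⟨r s₀, s₀, rfl⟩
  set α : ℝ := sInf (Set.range r) with hα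
  have hαle : ∀ s, α ≤ r s := fun s => csInf_le hbdd ⟨s, rfl⟩
  have hα0 : 0 < α := by
    have hlow : exp (-d) * r s₀ ≤ α := le_csInf hne (by
      rintro _ ⟨s, rfl⟩
      have h := hrr s₀ s
      have e : exp (-d) * (exp d * r s) = r s := by rw [← mul_assoc, ← exp_add]; simp
      calc exp (-d) * r s₀ ≤ exp (-d) * (exp d * r s) := mul_le_mul_of_nonneg_left h (exp_pos _).le
        _ = r s := e)
    exact lt_of_lt_of_le (mul_pos (exp_pos _) (hr0 s₀)) hlow
  have hp : (1 : ℝ) ≤ exp (d / 2) := one_le_exp (by linarith)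
  have hq : (1 : ℝ) ≤ exp (Δ / 2) := one_le_exp (by linarith)
  have hp2 : exp (d / 2) ^ 2 = exp d := by rw [sq, ← exp_add]; ring_nf
  have hq2 : exp (Δ / 2) ^ 2 = exp Δ := by rw [sq, ← exp_add]; ring_nf
  have hpq : exp (d / 2) * exp (Δ / 2) = exp ((d + Δ) / 2) := by rw [← exp_add]; ring_nf
  have hlo : ∀ s, α * x s ≤ y s := fun s => by
    have := (le_div_iff₀ (hx s)).1 (hαle s)
    simpa [hr] using this
  have hhi : ∀ s, y s ≤ exp (d / 2) ^ 2 * (α * x s) := by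
    intro s
    rw [hp2]
    have hup : r s ≤ exp d * α := by
      have : r s / exp d ≤ α := le_csInf hne (by
        rintro _ ⟨s', rfl⟩
        rw [div_le_iff₀ (exp_pos d), mul_comm]
        exact hrr s s')
      rwa [div_le_iff₀ (exp_pos d), mul_comm] at this
    have := (div_le_iff₀ (hx s)).1 (show y s / x s ≤ exp d * α from hup)
    calc y s ≤ exp d * α * x s := this
      _ = exp d * (α * x s) := by ring
  have hab' : ∀ s s', a s * b s' ≤ exp (Δ / 2) ^ 2 * (a s' * b s) := fun s s' => by rw [hq2]; exact hab s s'
  have h := integral_mul_integral_le_birkhoff hp hq hα0 ha hb hx hlo hhi hab' hax hay hbx hby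
  rw [hpq] at h
  exact h

/-- **★★ … WITH THE COEFFICIENT FOLDED IN**: `(∫ a y)(∫ b x) ≤ e^{tanh(Δ∕4)·d}·(∫ a x)(∫ b y)`. [folklore] (Hopf 1963; Eveson–Nussbaum 1995 Thm 3.5) -/
theorem integral_mul_integral_le_exp_tanh_mul (hd : 0 ≤ d) (hΔ : 0 ≤ Δ)
    (ha : ∀ s, 0 < a s) (hb : ∀ s, 0 < b s) (hx : ∀ s, 0 < x s) (hy : ∀ s, 0 < y s)
    (hxy : ∀ s s', y s * x s' ≤ exp d * (x s * y s')) (hab : ∀ s s', a s * b s' ≤ exp Δ * (a s' * b s))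
    (hax : Integrable (fun s => a s * x s) μ) (hay : Integrable (fun s => a s * y s) μ)
    (hbx : Integrable (fun s => b s * x s) μ) (hby : Integrable (fun s => b s * y s) μ) :
    (∫ s, a s * y s ∂μ) * (∫ s, b s * x s ∂μ) ≤ exp (Real.tanh (Δ / 4) * d) * ((∫ s, a s * x s ∂μ) * (∫ s, b s * y s ∂μ)) := by
  have h := integral_mul_integral_le_birkhoff_exp hd hΔ ha hb hx hy hxy hab hax hay hbx hby
  have hP : 0 < exp (d / 2) + exp (Δ / 2) := by positivity
  have hQ : 0 < exp ((d + Δ) / 2) + 1 := by positivity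
  have hAx : 0 ≤ ∫ s, a s * x s ∂μ := integral_nonneg fun s => (mul_pos (ha s) (hx s)).le
  have hBy : 0 ≤ ∫ s, b s * y s ∂μ := integral_nonneg fun s => (mul_pos (hb s) (hy s)).le
  have hZ : 0 < (exp ((d + Δ) / 2) + 1) / (exp (d / 2) + exp (Δ / 2)) := div_pos hQ hP
  have hexp : exp (2 * log ((exp ((d + Δ) / 2) + 1) / (exp (d / 2) + exp (Δ / 2))))
      = ((exp ((d + Δ) / 2) + 1) / (exp (d / 2) + exp (Δ / 2))) ^ 2 := by
    rw [show (2 : ℝ) * log ((exp ((d + Δ) / 2) + 1) / (exp (d / 2) + exp (Δ / 2)))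
        = ((2 : ℕ) : ℝ) * log ((exp ((d + Δ) / 2) + 1) / (exp (d / 2) + exp (Δ / 2))) by norm_num,
      ← log_pow, exp_log (pow_pos hZ 2)]
  calc (∫ s, a s * y s ∂μ) * (∫ s, b s * x s ∂μ)
      ≤ (∫ s, a s * x s ∂μ) * (∫ s, b s * y s ∂μ) * (exp ((d + Δ) / 2) + 1) ^ 2 / (exp (d / 2) + exp (Δ / 2)) ^ 2 :=
        (le_div_iff₀ (pow_pos hP 2)).2 h
    _ = ((exp ((d + Δ) / 2) + 1) / (exp (d / 2) + exp (Δ / 2))) ^ 2 * ((∫ s, a s * x s ∂μ) * (∫ s, b s * y s ∂μ)) := by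
        rw [div_pow]; ring
    _ ≤ exp (Real.tanh (Δ / 4) * d) * ((∫ s, a s * x s ∂μ) * (∫ s, b s * y s ∂μ)) := by
        rw [← hexp]
        exact mul_le_mul_of_nonneg_right (exp_le_exp.2 (two_mul_log_birkhoff_le_tanh_mul hd hΔ)) (mul_nonneg hAx hBy)

/-- **★ WEAK BOUND I — MONOTONICITY** [folklore]: ANY non-negative rows never expand the distance: `(∫ a y)(∫ b x) ≤ e^d·(∫ a x)(∫ b y)`. -/
theorem integral_mul_integral_le_exp_dist (ha : ∀ s, 0 ≤ a s) (hb : ∀ s, 0 ≤ b s)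
    (hxy : ∀ s s', y s * x s' ≤ exp d * (x s * y s'))
    (hax : Integrable (fun s => a s * x s) μ) (hay : Integrable (fun s => a s * y s) μ)
    (hbx : Integrable (fun s => b s * x s) μ) (hby : Integrable (fun s => b s * y s) μ) :
    (∫ s, a s * y s ∂μ) * (∫ s, b s * x s ∂μ) ≤ exp d * ((∫ s, a s * x s ∂μ) * (∫ s, b s * y s ∂μ)) := by
  rw [← integral_prod_mul, ← integral_prod_mul, ← integral_const_mul]
  refine integral_mono (hay.mul_prod hbx) ((hax.mul_prod hby).const_mul _) fun z => ?_
  calc a z.1 * y z.1 * (b z.2 * x z.2) = (a z.1 * b z.2) * (y z.1 * x z.2) := by ring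
    _ ≤ (a z.1 * b z.2) * (exp d * (x z.1 * y z.2)) :=
        mul_le_mul_of_nonneg_left (hxy z.1 z.2) (mul_nonneg (ha z.1) (hb z.2))
    _ = exp d * (a z.1 * x z.1 * (b z.2 * y z.2)) := by ring

/-- **WEAK BOUND II — THE DIAMETER** [folklore]: for ANY non-negative vectors the image distance is at most the rows' diameter:
`(∫ a y)(∫ b x) ≤ e^Δ·(∫ a x)(∫ b y)`. -/
theorem integral_mul_integral_le_exp_diam (hx : ∀ s, 0 ≤ x s) (hy : ∀ s, 0 ≤ y s)
    (hab : ∀ s s', a s * b s' ≤ exp Δ * (a s' * b s))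
    (hax : Integrable (fun s => a s * x s) μ) (hay : Integrable (fun s => a s * y s) μ)
    (hbx : Integrable (fun s => b s * x s) μ) (hby : Integrable (fun s => b s * y s) μ) :
    (∫ s, a s * y s ∂μ) * (∫ s, b s * x s ∂μ) ≤ exp Δ * ((∫ s, a s * x s ∂μ) * (∫ s, b s * y s ∂μ)) := by
  rw [mul_comm (∫ s, a s * x s ∂μ), ← integral_prod_mul, ← integral_prod_mul, ← integral_const_mul]
  refine integral_mono (hay.mul_prod hbx) ((hby.mul_prod hax).const_mul _) fun z => ?_
  calc a z.1 * y z.1 * (b z.2 * x z.2) = (a z.1 * b z.2) * (y z.1 * x z.2) := by ring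
    _ ≤ (exp Δ * (a z.2 * b z.1)) * (y z.1 * x z.2) :=
        mul_le_mul_of_nonneg_right (hab z.1 z.2) (mul_nonneg (hy z.1) (hx z.2))
    _ = exp Δ * (b z.1 * y z.1 * (a z.2 * x z.2)) := by ring

end TwoRows

/-! ## §3 Iteration: a chain of density kernels of diameter `≤ Δ` contracts geometrically -/

section Chain

variable [SFinite μ] {k : ℕ → X → X → ℝ} {fA fB : ℕ → X → ℝ} {ω₀ Δ : ℝ}

omit [SFinite μ] in
/-- positivity of the evolved densities. [folklore] -/
theorem densityChain_pos (hμ : μ ≠ 0) (hk : ∀ j x y, 0 < k j x y) (hA0 : ∀ x, 0 < fA 0 x)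
    (hAs : ∀ j y, fA (j + 1) y = ∫ x, k j x y * fA j x ∂μ) (hint : ∀ j y, Integrable (fun x => k j x y * fA j x) μ)
    (n : ℕ) : ∀ y, 0 < fA n y := by
  induction n with
  | zero => exact hA0
  | succ n ih =>
    intro y
    rw [hAs n y]
    exact integral_pos_of_pos hμ (fun x => mul_pos (hk n x y) (ih x)) (hint n y)

/-- **★★ GEOMETRIC CONTRACTION ALONG A CHAIN OF DENSITY KERNELS** [folklore] (Hopf 1963; Eveson–Nussbaum 1995 Thm 3.5).  Two positive densities evolved by
the SAME positive kernels `k j` of cross-ratio diameter `≤ Δ` (`f (j+1) y = ∫ k j x y · f j x dμ`), whose initial Hilbert distance is `≤ ω₀`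
(`fB 0 x · fA 0 x′ ≤ e^{ω₀}·fA 0 x·fB 0 x′`), are at distance `≤ tanh(Δ∕4)^n·ω₀` after `n` steps — the measure-space twin of
`…N19BirkhoffContraction.chain_dist_le_pow`. -/
theorem densityChain_dist_le_pow (hμ : μ ≠ 0) (hω₀ : 0 ≤ ω₀) (hΔ : 0 ≤ Δ) (hk : ∀ j x y, 0 < k j x y)
    (hdiam : ∀ (j : ℕ) (y y' x x' : X), k j x y * k j x' y' ≤ exp Δ * (k j x' y * k j x y'))
    (hA0 : ∀ x, 0 < fA 0 x) (hB0 : ∀ x, 0 < fB 0 x)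
    (hAs : ∀ j y, fA (j + 1) y = ∫ x, k j x y * fA j x ∂μ) (hBs : ∀ j y, fB (j + 1) y = ∫ x, k j x y * fB j x ∂μ)
    (hint : ∀ j y, Integrable (fun x => k j x y * fA j x) μ) (hintB : ∀ j y, Integrable (fun x => k j x y * fB j x) μ)
    (h0 : ∀ x x', fB 0 x * fA 0 x' ≤ exp ω₀ * (fA 0 x * fB 0 x')) (n : ℕ) :
    ∀ x x', fB n x * fA n x' ≤ exp (Real.tanh (Δ / 4) ^ n * ω₀) * (fA n x * fB n x') := by
  induction n with
  | zero => simpa only [pow_zero, one_mul] using h0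
  | succ n ih =>
    intro y y'
    have hAn := densityChain_pos hμ hk hA0 hAs hint n
    have hBn := densityChain_pos hμ hk hB0 hBs hintB n
    have hdn : 0 ≤ Real.tanh (Δ / 4) ^ n * ω₀ := mul_nonneg (pow_nonneg (tanh_quarter_nonneg hΔ) n) hω₀
    have e : Real.tanh (Δ / 4) ^ (n + 1) * ω₀ = Real.tanh (Δ / 4) * (Real.tanh (Δ / 4) ^ n * ω₀) := by ring
    rw [hBs n y, hAs n y', hAs n y, hBs n y', e]
    exact integral_mul_integral_le_exp_tanh_mul (μ := μ) (a := fun x => k n x y) (b := fun x => k n x y') (x := fA n) (y := fB n)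
      hdn hΔ (fun x => hk n x y) (fun x => hk n x y') hAn hBn ih (fun x x' => hdiam n y y' x x')
      (hint n y) (hintB n y) (hint n y') (hintB n y')

end Chain

end Summit.QuantumFields.YangMills.BalabanUVNodes.N19BirkhoffContractionIntegral

end
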